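import Mathlib
import HarnessLib
import Literature.Computability.AlgebraicComplexity.DegenerationSpectralMonotone
import Literature.Computability.AlgebraicComplexity.BorderRankCWKoszulRanksSqThree
import Summits.MatrixMultiplication.MatrixMultiplication.Theorems.OutsiderSandwichBorderSubrankSeven
import Summits.MatrixMultiplication.MatrixMultiplication.Theorems.OutsiderSandwichBorderSubrankTwenty
import Summits.MatrixMultiplication.MatrixMultiplication.Theorems.OutsiderSandwichHammingBound

/-!
# OutsiderSandwich — `⟨21⟩ ⊴₁₀₁ cw₂^{⊠3}`: the border subrank of `cw₂^{⊠3}` reaches the subrank ceiling `21`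
(decomp-mm lens 4 «minimal-counterexample / extremal reduction», gen 42, kernel K42-h; THESES-FREE;
definitions = the certificate tables only, as in K42-d/e/g)

Host: `cw₂^{⊠3} = kroneckerPow (cwTensor R 2) 3` on `Fin 3 → Fin 3` (support `Φ₃`, `216` triples).  In kernel before this file:
restriction `14 ≤ Q(cw₂^{⊠3}) ≤ 21` (`OutsiderSandwichCwCubeSubrank.fourteen_le_subrank_cwPow_three_complex`,
`OutsiderSandwichHammingBound.subrank_cwPow_three_le`); degeneration `⟨20⟩ ⊴₅₆ cw₂^{⊠3}` (K42-g) and `⟨27⟩ ⋬ cw₂^{⊠3}` (K42-f).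

**This file proves:**

* `cert₁`, `cert₂`, `isApproxRestriction` — a second, larger explicit COMBINATORIAL degeneration (BCS (15.29)–(15.30)),
  certified through K42-g's `isApproxRestriction_of_monomial`: a diagonal `Ψ ⊂ Φ₃` of size `21` (tables `σA σB σC`) and
  weights `wA ≤ 74`, `wB ≤ 87`, `wC ≤ 50` with `wA + wB + wC = 101` exactly on `Ψ` and `≥ 102` on the other `79` triples of
  `Φ₃` inside the used coordinates.  Found by simulated annealing over size-21 diagonals of `Φ₃` with the phase-1 LP
  infeasibility as energy (`lpdiag.c`, mode 1, `T₀ = 1`, seed 14: `2 168` LP evaluations), weights by exact rational LP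
  (`lp3_intK.py`: least order with non-negative weights is `84` with a fractional vertex; `101` is the least order found with an
  integral vertex), verified independently (`mk_u21_tables.py`) and here by `decide` over `ℤ`, one target row at a time.
* `unitTensor_twentyOne_deg_cwTwoPow_three` — `⟨21⟩ ⊴ cw₂^{⊠3}` over every commutative ring; instance over `ℂ`.
* `subrank_le_border_witness_cwPow_three` — over `ℂ`: `Q(cw₂^{⊠3}) ≤ 21` (HammingBound, restated by name only as a conjunct)
  AND `⟨21⟩ ⊴ cw₂^{⊠3}`: at `N = 3` the border subrank is at least the best restriction ceiling in kernel.  (At `N = 2` the two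
  orders are separated, `Q = 6 < 7 ≤ Q̲`, K42-e; at `N = 3` a separation by order alone would need `⟨22⟩ ⊴`, not found: §census.)

Census reading (decomp-mm lens 4; `LaserTangency`, stmt-32268, is instrumented by RESTRICTION tables): degeneration cell
`(3,1) ∈ [21, 26]`, restriction cell `(3,1) ∈ [14, 21]`; per-copy border rate `21^{1/3} ≈ 2.759`.  Size `21` recurs (three of
four annealing runs, `2 168 … 28 234` evaluations); size `22` was NOT found (`8` runs × `≈ 21 000` evaluations, `T₀ ∈ {0.5, …, 3}`, best
infeasibility `27`); not exhaustive.  No `sorry`, standard axioms, no `native_decide`.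
-/

set_option linter.dupNamespace false

namespace Summit.MatrixMultiplication.MatrixMultiplication.Theorems.OutsiderSandwichBorderSubrankTwentyOne

open scoped BigOperators Polynomial
open Polynomial (X C)
open Literature.Computability.AlgebraicComplexity
open Summit.MatrixMultiplication.MatrixMultiplication.Theorems.OutsiderSandwichBorderSubrankSeven
  (intCast_unitTensor)
open Summit.MatrixMultiplication.MatrixMultiplication.Theorems.OutsiderSandwichBorderSubrankTwenty
  (isApproxRestriction_of_monomial hostZ hostZ_eq)

variable {R : Type} [CommRing R]

/-! ## The certificate: a size-21 diagonal of `Φ₃` and its weights -/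

/-- Leg-`A` host coordinate (an index `Fin 3 → Fin 3` of `cw₂^{⊠3}`) of each of the `21` target coordinates. -/
def σA : Fin 21 → Fin 3 → Fin 3 :=
  ![![0, 0, 0], ![0, 0, 1], ![0, 0, 2], ![0, 1, 0], ![0, 1, 1], ![0, 2, 0], ![0, 2, 1], ![1, 0, 1],
    ![1, 0, 2], ![1, 1, 2], ![1, 2, 0], ![1, 2, 1], ![1, 2, 2], ![2, 0, 1], ![2, 0, 2], ![2, 1, 0],
    ![2, 1, 1], ![2, 1, 2], ![2, 2, 0], ![2, 2, 1], ![2, 2, 2]]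

/-- Leg-`A` weights (exponents of `ε`). -/
def wA : Fin 21 → ℕ :=
  ![34, 9, 0, 49, 32, 15, 26, 36, 32, 60, 21, 56, 66, 38, 33, 74, 65, 67, 0, 54, 47]

/-- Leg-`B` host coordinate of each target coordinate. -/
def σB : Fin 21 → Fin 3 → Fin 3 :=
  ![![1, 1, 1], ![1, 2, 1], ![2, 1, 0], ![1, 1, 2], ![2, 0, 0], ![2, 0, 2], ![1, 2, 0], ![1, 1, 0],
    ![0, 1, 0], ![1, 0, 0], ![1, 2, 2], ![0, 0, 0], ![1, 0, 2], ![2, 2, 0], ![2, 1, 2], ![0, 1, 1],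
    ![2, 1, 1], ![0, 1, 2], ![2, 2, 1], ![0, 0, 1], ![0, 2, 0]]

/-- Leg-`B` weights. -/
def wB : Fin 21 → ℕ :=
  ![33, 67, 64, 42, 37, 36, 55, 65, 32, 36, 77, 5, 16, 52, 35, 3, 36, 0, 87, 41, 26]

/-- Leg-`C` host coordinate of each target coordinate. -/
def σC : Fin 21 → Fin 3 → Fin 3 :=
  ![![1, 1, 1], ![1, 2, 0], ![2, 1, 2], ![1, 0, 2], ![2, 1, 1], ![2, 2, 2], ![1, 0, 1], ![0, 1, 1],
    ![1, 1, 2], ![0, 1, 2], ![0, 0, 2], ![1, 2, 1], ![0, 2, 0], ![0, 2, 1], ![0, 1, 0], ![2, 0, 1],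
    ![0, 0, 0], ![2, 0, 0], ![0, 0, 1], ![2, 2, 0], ![2, 0, 2]]

/-- Leg-`C` weights. -/
def wC : Fin 21 → ℕ :=
  ![34, 25, 37, 10, 32, 50, 20, 0, 37, 5, 3, 40, 19, 11, 33, 24, 0, 34, 14, 6, 28]

/-- Nothing below order `101`: every host entry met at weight `< 101` vanishes (by `decide`, row by row). -/
theorem cert₁ : ∀ x y z : Fin 21, wA x + wB y + wC z < 101 → hostZ (σA x) (σB y) (σC z) = 0 := by
  intro x
  fin_cases x <;> decide

/-- The order-`101` layer is `⟨21⟩` (by `decide`, row by row). -/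
theorem cert₂ : ∀ x y z : Fin 21,
    (if wA x + wB y + wC z = 101 then hostZ (σA x) (σB y) (σC z) else 0) = unitTensor ℤ 21 x y z := by
  intro x
  fin_cases x <;> decide

/-! ## `⟨21⟩ ⊴ cw₂^{⊠3}` -/

variable (R)

/-- The combinatorial degeneration of order `101`, as an approximate restriction with monomial matrices.
[cite: BurgisserClausenShokrollahi1997, (15.30)] -/
theorem isApproxRestriction :
    IsApproxRestriction 101 (kroneckerPow (cwTensor R 2) 3) (unitTensor R 21)
      (fun x a => if a = σA x then (X : R[X]) ^ (wA x) else 0)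
      (fun y b => if b = σB y then (X : R[X]) ^ (wB y) else 0)
      (fun z c => if c = σC z then (X : R[X]) ^ (wC z) else 0) := by
  refine isApproxRestriction_of_monomial 101 _ _ σA σB σC wA wB wC ?_ ?_
  · intro x y z h
    rw [← intCast_kroneckerPow_cwTensor R 2 3, hostZ_eq, cert₁ x y z h, Int.cast_zero]
  · intro x y z
    rw [← intCast_kroneckerPow_cwTensor R 2 3, hostZ_eq, ← intCast_unitTensor R 21 x y z, ← cert₂ x y z]
    split_ifs <;> simp

/-- **`⟨21⟩ ⊴ cw₂^{⊠3}`**: the unit tensor of size `21` is a degeneration (of order `101`) of the Kronecker cube of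
`T_{cw,2}`, over every commutative ring. [new] -/
theorem unitTensor_twentyOne_deg_cwTwoPow_three :
    AlgDegeneratesTo (kroneckerPow (cwTensor R 2) 3) (unitTensor R 21) :=
  ⟨101, _, _, _, isApproxRestriction R⟩

/-- Over `ℂ`: `⟨21⟩ ⊴ cw₂^{⊠3}`. [new] -/
theorem unitTensor_twentyOne_deg_cwTwoPow_three_complex :
    AlgDegeneratesTo (kroneckerPow (cwTensor ℂ 2) 3) (unitTensor ℂ 21) :=
  unitTensor_twentyOne_deg_cwTwoPow_three ℂ

/-- **Border subrank meets the subrank ceiling at `N = 3`**: `Q(cw₂^{⊠3}) ≤ 21` (the Hamming-bound ceiling,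
`OutsiderSandwichHammingBound.subrank_cwPow_three_le`) while `⟨21⟩` is a degeneration of `cw₂^{⊠3}`. [new] -/
theorem subrank_le_border_witness_cwPow_three :
    subrank ℂ (kroneckerPow (cwTensor ℂ 2) 3) ≤ 21 ∧
      AlgDegeneratesTo (kroneckerPow (cwTensor ℂ 2) 3) (unitTensor ℂ 21) :=
  ⟨OutsiderSandwichHammingBound.subrank_cwPow_three_le, unitTensor_twentyOne_deg_cwTwoPow_three ℂ⟩

end Summit.MatrixMultiplication.MatrixMultiplication.Theorems.OutsiderSandwichBorderSubrankTwentyOne
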